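import Literature.InformationTheory.QuantumCodes.TwistedToricDistance
import Literature.InformationTheory.QuantumCodes.TwoBlockCosetDecomposition
import Literature.InformationTheory.QuantumCodes.TwoBlockCodeEquivalences
import HarnessLib

/-!
# Weight-four two-block codes: `n ≥ d²`, and `n ≥ d² + 1` for odd `d` (Wang–Pryadko 2022, Statement 14) — proof

Topic `InformationTheory/QuantumCodes`; namespace `Literature.InformationTheory.QuantumCodes.TwistedToric`
(the lattice statements) and `…AbelianTwoBlock` (the code statements). LADDER-QEC (cell `qec`), LIT-3
constructions register T-row «W = 4 two-block / GB codes».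

Source followed. R. Wang, L. P. Pryadko, *Distance bounds for generalized bicycle codes*, Symmetry **14**
(2022) 1348 = arXiv:2203.17216 [WangPryadko2022], §3.5 «Exact bound for GB codes of weight four» (held text
`paper:arxiv-2203.17216`, chunk p0010):

> (L36–57) «start with an arbitrary vertex `i ∈ 𝒱_ℋ` … and consider a vertex-centered ball `B_r(i)` on `ℋ`
> [the square lattice] … if the size of the ball satisfies `|B_r(i)| > ℓ`, the ball must include at least two
> equivalent vertices, which gives for the code distance, `d_Z ≤ 2r`, the diameter of the ball. The size of a
> ball on the square lattice is … `|B_r(i)| − 1 = 4 + 8 + … + 4r = 2r(r+1)`, which gives the upper bound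
> `d_Z ≤ 2r` for any circulant size `ℓ < 1 + 2r(r+1)`. A similar calculation for an edge-centered ball on `ℋ`
> gives an odd-valued upper bound `d_Z ≤ 2r+1` for any `ℓ < 2(r+1)²».
> **Statement 14** (L59–63). «Consider a weight-four GB code of an odd distance `d = 2r+1`, then its length
> `n ≥ 1 + d²`. For an even distance `d = 2r`, the length `n ≥ d²`.» (L65–66) «The argument above is valid for
> `d ≥ 3`. We verified by exhaustive search that these inequalities are also valid for `d ∈ {1,2}`.»

H.-K. Lin, L. P. Pryadko, *Quantum two-block group algebra codes*, PRA **109** (2024) 022407 = arXiv:2306.16400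
[LinPryadko2024], §IV.G «2BGA codes with row weights `W ≤ 4`» (chunk p0012 L44–97) extend it to two-block
group-algebra codes: «up to code equivalence, we can choose `a = 1 + λf`, `b = 1 + μh` … a counting argument
identical to that used in the proof of Statement 14 from Ref. [Wang-Pryadko-2022] gives an upper bound for the
`W = 4` double-coset subcode distances … `(d_μ^{(g)})² ≤ n^{(g)}`, `μ ∈ {X,Z}`, which also gives `d² ≤ n^{(g)} − 1`
when `d ≡ d^{(g)}` is odd.»

## What is proved (0 definitions of notions, 0 named facts)

The tree already has the weight-four abelian two-block code `LP[1 + x^{g₁}, 1 + x^{g₂}]` over a finite abelian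
group `G` as `TwistedToric.code g₁ g₂` (qec-type-08, `TwistedToricCodes.lean`), its period lattice
`Λ = {m ∈ ℤ² : m₁•g₁ + m₂•g₂ = 0}` (`IsPeriod`), the `L¹` systole `systole g₁ g₂ = sys₁(Λ)` and the distance
formula `d_Z = d_X = sys₁(Λ)` for GENERATING `g₁, g₂` (`code_dZ`, `code_dX`, `TwistedToricDistance.lean`). In
this vocabulary the printed counting argument is a lattice statement, which we prove for EVERY finite abelian
group (the GB case of the source is `G = ℤ_ℓ`; the printed restriction `d ≥ 3` and the exhaustive search for
`d ∈ {1, 2}` are not needed, because the tree's distance formula holds for all `d`):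

* `exists_isPeriod_of_card_lt` — the pigeonhole engine: an injective family of more than `|G|` points of `ℤ²`
  with pairwise `L¹` distances `≤ D` contains two points with the same image in `G`, whose difference is a
  nonzero period of length `≤ D`;
* `systole_le_two_mul_of_card_lt` — the vertex-centred ball: `|G| < 2r² + 2r + 1 ⟹ sys₁(Λ) ≤ 2r`
  [WangPryadko2022, §3.5 (p0010 L36–52)];
* `systole_le_two_mul_add_one_of_card_lt` — the edge-centred ball: `|G| < 2(r+1)² ⟹ sys₁(Λ) ≤ 2r + 1`
  [WangPryadko2022, §3.5 (p0010 L52–54)];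
* `systole_sq_le_two_mul_card`, `systole_sq_lt_two_mul_card_of_odd` — hence `sys₁(Λ)² ≤ 2|G|`, and
  `sys₁(Λ)² < 2|G|` when `sys₁(Λ)` is odd (Statement 14 in lattice form);
* `code_dZ_eq_systole`, `code_dX_eq_systole` — the distance formula `d_Z = d_X = sys₁(Λ)` for ALL nonzero
  `g₁, g₂` (the tree's theorem assumed `⟨g₁, g₂⟩ = G`; a non-generating pair gives `[G : ⟨g₁,g₂⟩]` disjoint copies
  of the code over `⟨g₁, g₂⟩`, `TwoBlockCosetDecomposition.lean`, with the same period lattice);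
* `code_dZ_sq_le_card`, `code_dZ_sq_lt_card_of_odd` (and `dX` twins) — **Statement 14 for `code g₁ g₂`**:
  `d² ≤ n = 2|G|`, and `d² + 1 ≤ n` for odd `d`;
* `AbelianTwoBlock.css_dZ_sq_le_card_of_weight_two`, `…_lt_…_of_odd` (and `dX` twins) — **Statement 14 /
  LP24 §IV.G for every abelian two-block code `css a b` whose two blocks have weight exactly two** (GB codes:
  `G = ℤ_ℓ`; BB / abelian 2BGA codes likewise), via the translation equivalence `LP[a,b] ≅ LP[aα, βb]` of the
  tree (`css_shift_dZ`, LP24 Thm 6(iv)) which brings `a, b` to the form `1 + x^{g}`.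

Sharpness of the odd bound (the source's remark after Statement 14, p0010 L68–72: the family with periodicity
vectors `(r+1, r)`, `(−r, r+1)` and parameters `[[(2r+1)²+1, 2, 2r+1]]`) is the tree's
`TwistedToric.systole_cyclic` (`TwistedToricRotatedFamily.lean`, qec-type-08); not restated here.
-/

namespace Literature.InformationTheory.QuantumCodes

open Matrix Finset

namespace TwistedToric

/-! ## The pigeonhole engine and the two balls -/

section Lattice

variable {V : Type*} [AddCommGroup V]

/-- `l1 (−m) = l1 m`. [cite: KovalevPryadko2012, §III.C (p0005 L56: the norm ‖L‖₁ ≡ |a| + |b| of a lattice vector)] -/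
theorem l1_neg (m : ℤ × ℤ) : l1 (-m) = l1 m := by
  simp [l1]

/-- `l1 (m − m') ≤ l1 m + l1 m'`. [cite: KovalevPryadko2012, §III.C (p0005 L56: the norm ‖L‖₁ ≡ |a| + |b| of a lattice vector)] -/
theorem l1_sub_le (m m' : ℤ × ℤ) : l1 (m - m') ≤ l1 m + l1 m' := by
  rw [sub_eq_add_neg, ← l1_neg m']
  exact l1_add_le m (-m')

/-- **Pigeonhole on the covering map `ℤ² → V`.** An injective family of more than `|V|` lattice points with pairwise
`L¹` distances `≤ D` contains two points `p ≠ q` with `m₁•g₁ + m₂•g₂` equal, so `p − q` is a nonzero period of length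
`≤ D`. [cite: WangPryadko2022, §3.5 (arXiv:2203.17216 chunk p0010 L43–47: «if the size of the ball satisfies |B_r(i)| > ℓ, the ball must include at least two equivalent vertices, which gives for the code distance d_Z ≤ 2r, the diameter of the ball»)] -/
theorem exists_isPeriod_of_card_lt [Fintype V] (g₁ g₂ : V) {ι : Type*} [Fintype ι] (f : ι → ℤ × ℤ)
    (hf : Function.Injective f) {D : ℕ} (hD : ∀ i j, l1 (f i - f j) ≤ D)
    (hcard : Fintype.card V < Fintype.card ι) :
    ∃ m : ℤ × ℤ, IsPeriod g₁ g₂ m ∧ m ≠ 0 ∧ l1 m ≤ D := by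
  obtain ⟨i, j, hij, hrel⟩ := Fintype.exists_ne_map_eq_of_card_lt (fun i => rel g₁ g₂ (f i)) hcard
  refine ⟨f j - f i, isPeriod_sub_of_rel_eq hrel, ?_, hD j i⟩
  intro h
  exact hij (hf (sub_eq_zero.mp h).symm)

/-- The rotated parametrisation of the lattice points of a diamond: `(u, v) ↦ (u + v − r + s, u − v)`
(`0 ≤ u, v ≤ r`; `s` a horizontal offset). (definition, auxiliary)
[cite: WangPryadko2022, §3.5 (arXiv:2203.17216 chunk p0010 L36–54: the vertex-centred ball B_r(i) and the edge-centred ball on the square lattice)] -/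
def rot (r k : ℕ) (s : ℤ) (p : Fin k × Fin k) : ℤ × ℤ :=
  (((p.1 : ℕ) : ℤ) + ((p.2 : ℕ) : ℤ) - r + s, ((p.1 : ℕ) : ℤ) - ((p.2 : ℕ) : ℤ))

/-- Points of the rotated square of side `r + 1` centred at the origin lie in the `L¹` ball of radius `r`.
[cite: WangPryadko2022, §3.5 (arXiv:2203.17216 chunk p0010 L36–52: the ball B_r(i) of graph-distance radius r)] -/
theorem l1_rot_le (r : ℕ) (p : Fin (r + 1) × Fin (r + 1)) : l1 (rot r (r + 1) 0 p) ≤ r := by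
  obtain ⟨⟨u, hu⟩, ⟨v, hv⟩⟩ := p
  simp only [rot, l1, add_zero]
  omega

/-- Points of the rotated square of side `r` shifted by `(1, 0)`… more precisely `(u,v) ↦ (u+v−r+1, u−v)` with
`u, v < r`, lie in the `L¹` ball of radius `r` (indeed `r − 1`). [cite: WangPryadko2022, §3.5 (arXiv:2203.17216 chunk p0010 L47–52: |B_r(i)| − 1 = 4 + 8 + … + 4r = 2r(r+1))] -/
theorem l1_rot_le' (r : ℕ) (p : Fin r × Fin r) : l1 (rot r r 1 p) ≤ r := by
  obtain ⟨⟨u, hu⟩, ⟨v, hv⟩⟩ := p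
  simp only [rot, l1]
  omega

/-- `rot r k s` is injective for fixed `s`. [cite: WangPryadko2022, §3.5 (arXiv:2203.17216 chunk p0010 L47–52: counting the points of the ball)] -/
theorem rot_injective (r k : ℕ) (s : ℤ) : Function.Injective (rot r k s) := by
  rintro ⟨⟨u, hu⟩, ⟨v, hv⟩⟩ ⟨⟨u', hu'⟩, ⟨v', hv'⟩⟩ h
  simp only [rot, Prod.mk.injEq] at h
  obtain ⟨h1, h2⟩ := h
  have hu : u = u' := by omega
  have hv : v = v' := by omega
  subst hu; subst hv; rfl

/-- Points of `rot r k 0` and of `rot r k' 1` are distinct (the coordinate sums have different parities).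
[cite: WangPryadko2022, §3.5 (arXiv:2203.17216 chunk p0010 L47–54: the vertex-centred and edge-centred counts)] -/
theorem rot_zero_ne_rot_one (r k k' : ℕ) (p : Fin k × Fin k) (q : Fin k' × Fin k') :
    rot r k 0 p ≠ rot r k' 1 q := by
  intro h
  simp only [rot, Prod.mk.injEq, add_zero] at h
  omega

/-- The lattice points of the **vertex-centred ball** `B_r(0) = {m : |m₁| + |m₂| ≤ r}`, `2r² + 2r + 1` of them,
as an injective family. (definition, auxiliary) [cite: WangPryadko2022, §3.5 (arXiv:2203.17216 chunk p0010 L36–52: |B_r(i)| = 1 + 2r(r+1))] -/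
def vertexBall (r : ℕ) : (Fin (r + 1) × Fin (r + 1)) ⊕ (Fin r × Fin r) → ℤ × ℤ :=
  Sum.elim (rot r (r + 1) 0) (rot r r 1)

/-- The lattice points of the **edge-centred ball** `{m : |2m₁ − 1| + |2m₂| ≤ 2r + 1} = B_r(0) ∪ (B_r(0) + (1,0))`,
`2(r+1)²` of them, as an injective family. (definition, auxiliary)
[cite: WangPryadko2022, §3.5 (arXiv:2203.17216 chunk p0010 L52–54: «a similar calculation for an edge-centered ball on ℋ gives an odd-valued upper bound d_Z ≤ 2r+1 for any ℓ < 2(r+1)²»)] -/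
def edgeBall (r : ℕ) : (Fin (r + 1) × Fin (r + 1)) ⊕ (Fin (r + 1) × Fin (r + 1)) → ℤ × ℤ :=
  Sum.elim (rot r (r + 1) 0) (rot r (r + 1) 1)

/-- `vertexBall r` is injective. [cite: WangPryadko2022, §3.5 (arXiv:2203.17216 chunk p0010 L47–52)] -/
theorem vertexBall_injective (r : ℕ) : Function.Injective (vertexBall r) := by
  rintro (p | p) (q | q) h
  · exact congrArg Sum.inl (rot_injective r (r + 1) 0 h)
  · exact absurd h (rot_zero_ne_rot_one r (r + 1) r p q)
  · exact absurd h.symm (rot_zero_ne_rot_one r (r + 1) r q p)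
  · exact congrArg Sum.inr (rot_injective r r 1 h)

/-- `edgeBall r` is injective. [cite: WangPryadko2022, §3.5 (arXiv:2203.17216 chunk p0010 L52–54)] -/
theorem edgeBall_injective (r : ℕ) : Function.Injective (edgeBall r) := by
  rintro (p | p) (q | q) h
  · exact congrArg Sum.inl (rot_injective r (r + 1) 0 h)
  · exact absurd h (rot_zero_ne_rot_one r (r + 1) (r + 1) p q)
  · exact absurd h.symm (rot_zero_ne_rot_one r (r + 1) (r + 1) q p)
  · exact congrArg Sum.inr (rot_injective r (r + 1) 1 h)

/-- The vertex-centred ball has diameter `≤ 2r`. [cite: WangPryadko2022, §3.5 (arXiv:2203.17216 chunk p0010 L45–47: «d_Z ≤ 2r, the diameter of the ball»)] -/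
theorem l1_vertexBall_sub_le (r : ℕ) (i j : (Fin (r + 1) × Fin (r + 1)) ⊕ (Fin r × Fin r)) :
    l1 (vertexBall r i - vertexBall r j) ≤ 2 * r := by
  have hi : l1 (vertexBall r i) ≤ r := by
    rcases i with p | p
    · exact l1_rot_le r p
    · exact l1_rot_le' r p
  have hj : l1 (vertexBall r j) ≤ r := by
    rcases j with p | p
    · exact l1_rot_le r p
    · exact l1_rot_le' r p
  have := l1_sub_le (vertexBall r i) (vertexBall r j)
  omega

/-- The edge-centred ball has diameter `≤ 2r + 1`. [cite: WangPryadko2022, §3.5 (arXiv:2203.17216 chunk p0010 L52–54: the edge-centred ball gives d_Z ≤ 2r+1)] -/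
theorem l1_edgeBall_sub_le (r : ℕ) (i j : (Fin (r + 1) × Fin (r + 1)) ⊕ (Fin (r + 1) × Fin (r + 1))) :
    l1 (edgeBall r i - edgeBall r j) ≤ 2 * r + 1 := by
  -- `rot r (r+1) 1 p = rot r (r+1) 0 p + (1, 0)`; both summands have `l1 ≤ r`
  have key : ∀ (p q : Fin (r + 1) × Fin (r + 1)) (s t : ℤ), s - t ∈ ({0, 1, -1} : Set ℤ) →
      l1 (rot r (r + 1) s p - rot r (r + 1) t q) ≤ 2 * r + 1 := by
    intro p q s t hst
    obtain ⟨⟨u, hu⟩, ⟨v, hv⟩⟩ := p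
    obtain ⟨⟨u', hu'⟩, ⟨v', hv'⟩⟩ := q
    simp only [rot, l1, Prod.fst_sub, Prod.snd_sub]
    simp only [Set.mem_insert_iff, Set.mem_singleton_iff] at hst
    rcases hst with h | h | h <;> omega
  rcases i with p | p <;> rcases j with q | q
  · exact key p q 0 0 (by simp)
  · exact key p q 0 1 (by simp)
  · exact key p q 1 0 (by simp)
  · exact key p q 1 1 (by simp)

/-- **Vertex-centred ball** [WangPryadko2022, §3.5]: if `|V| < 1 + 2r(r+1) = |B_r|` then the period lattice has a
nonzero vector of `L¹` length `≤ 2r`, so `sys₁(Λ) ≤ 2r`.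
[cite: WangPryadko2022, §3.5 (arXiv:2203.17216 chunk p0010 L43–52: «the upper bound d_Z ≤ 2r for any circulant size ℓ < 1 + 2r(r+1)»)] -/
theorem systole_le_two_mul_of_card_lt [Fintype V] (g₁ g₂ : V) {r : ℕ}
    (h : Fintype.card V < 2 * (r * r) + 2 * r + 1) : systole g₁ g₂ ≤ 2 * r := by
  have hcard : Fintype.card V < Fintype.card ((Fin (r + 1) × Fin (r + 1)) ⊕ (Fin r × Fin r)) := by
    simp only [Fintype.card_sum, Fintype.card_prod, Fintype.card_fin]
    convert h using 1; ring
  obtain ⟨m, hm, hm0, hl⟩ := exists_isPeriod_of_card_lt g₁ g₂ (vertexBall r) (vertexBall_injective r)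
    (l1_vertexBall_sub_le r) hcard
  exact (systole_le hm hm0).trans hl

/-- **Edge-centred ball** [WangPryadko2022, §3.5]: if `|V| < 2(r+1)²` then the period lattice has a nonzero vector
of `L¹` length `≤ 2r + 1`, so `sys₁(Λ) ≤ 2r + 1`.
[cite: WangPryadko2022, §3.5 (arXiv:2203.17216 chunk p0010 L52–54: «an odd-valued upper bound d_Z ≤ 2r+1 for any ℓ < 2(r+1)²»)] -/
theorem systole_le_two_mul_add_one_of_card_lt [Fintype V] (g₁ g₂ : V) {r : ℕ}
    (h : Fintype.card V < 2 * ((r + 1) * (r + 1))) : systole g₁ g₂ ≤ 2 * r + 1 := by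
  have hcard : Fintype.card V < Fintype.card ((Fin (r + 1) × Fin (r + 1)) ⊕ (Fin (r + 1) × Fin (r + 1))) := by
    simp only [Fintype.card_sum, Fintype.card_prod, Fintype.card_fin]
    convert h using 1; ring
  obtain ⟨m, hm, hm0, hl⟩ := exists_isPeriod_of_card_lt g₁ g₂ (edgeBall r) (edgeBall_injective r)
    (l1_edgeBall_sub_le r) hcard
  exact (systole_le hm hm0).trans hl

/-- **Statement 14, lattice form:** `sys₁(Λ)² ≤ 2|V|` for the period lattice of any pair in a finite abelian group.
[cite: WangPryadko2022, Statement 14 (arXiv:2203.17216 chunk p0010 L59–63: «For an even distance d = 2r, the length n ≥ d²» — and the odd case below, which is stronger)] -/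
theorem systole_sq_le_two_mul_card [Fintype V] (g₁ g₂ : V) :
    systole g₁ g₂ ^ 2 ≤ 2 * Fintype.card V := by
  by_contra hlt
  rw [not_le] at hlt
  set s := systole g₁ g₂ with hs
  obtain ⟨r', hr' | hr'⟩ := Nat.even_or_odd' s
  · -- `s = 2r'`: `|V| < 2r'²`, so the edge-centred ball of radius `r' − 1` gives `s ≤ 2r' − 1`
    rcases Nat.eq_zero_or_pos r' with h0 | hpos
    · rw [hr', h0] at hlt; simp at hlt
    · obtain ⟨r, rfl⟩ : ∃ r, r' = r + 1 := ⟨r' - 1, by omega⟩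
      have hV : Fintype.card V < 2 * ((r + 1) * (r + 1)) := by
        have : s ^ 2 = 4 * ((r + 1) * (r + 1)) := by rw [hr']; ring
        omega
      have := systole_le_two_mul_add_one_of_card_lt g₁ g₂ hV
      omega
  · -- `s = 2r' + 1`: `|V| < 2r'² + 2r' + 1`, so the vertex-centred ball gives `s ≤ 2r'`
    have hV : Fintype.card V < 2 * (r' * r') + 2 * r' + 1 := by
      have : s ^ 2 = 4 * (r' * r') + 4 * r' + 1 := by rw [hr']; ring
      omega
    have := systole_le_two_mul_of_card_lt g₁ g₂ hV
    omega

/-- **Statement 14, lattice form, odd case:** an odd systole satisfies `sys₁(Λ)² + 1 ≤ 2|V|`.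
[cite: WangPryadko2022, Statement 14 (arXiv:2203.17216 chunk p0010 L59–62: «Consider a weight-four GB code of an odd distance d = 2r+1, then its length n ≥ 1 + d²»)] -/
theorem systole_sq_lt_two_mul_card_of_odd [Fintype V] (g₁ g₂ : V) (hodd : Odd (systole g₁ g₂)) :
    systole g₁ g₂ ^ 2 < 2 * Fintype.card V := by
  by_contra hle
  rw [not_lt] at hle
  obtain ⟨r', hr'⟩ := hodd
  have hV : Fintype.card V < 2 * (r' * r') + 2 * r' + 1 := by
    have : systole g₁ g₂ ^ 2 = 4 * (r' * r') + 4 * r' + 1 := by rw [hr']; ring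
    omega
  have := systole_le_two_mul_of_card_lt g₁ g₂ hV
  omega

end Lattice

/-! ## The code statements: `d = sys₁(Λ)` for all nonzero `g₁, g₂`, and Statement 14 -/

section Code

variable {G : Type*} [AddCommGroup G] [DecidableEq G] [Fintype G] {g₁ g₂ : G}

omit [DecidableEq G] [Fintype G] in
/-- `binom g x ≠ 0` only for `x ∈ {0, g}`. [cite: KovalevPryadko2013Hyperbicycle, §III.B Ex. 2 (p0008 L11-13: f₁(x) = 1 + x^{2t²+1})] -/
theorem binom_eq_zero_of_ne [DecidableEq G] {g x : G} (h0 : x ≠ 0) (hg : x ≠ g) : binom g x = 0 := by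
  simp [binom, h0, hg]

omit [Fintype G] in
/-- Restricting `binom g` (with `g ∈ H`) to a subgroup `H` gives `binom ⟨g, _⟩` on `H`.
[cite: LinPryadko2024, §4.3 Statement 7 (arXiv:2306.16400 chunk p0010 L47–55: a double-coset subcode of an abelian 2BGA code is a 2BGA code over a subgroup)] -/
theorem restrict_binom (H : AddSubgroup G) {g : G} (hg : g ∈ H) :
    AbelianTwoBlock.restrict H (binom g) = binom (⟨g, hg⟩ : H) := by
  funext x
  simp only [AbelianTwoBlock.restrict, binom]
  have h1 : ((x : G) = 0) ↔ (x = 0) := by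
    rw [← ZeroMemClass.coe_zero H]; exact Subtype.coe_injective.eq_iff
  have h2 : ((x : G) = g) ↔ (x = ⟨g, hg⟩) := by
    constructor
    · intro h; exact Subtype.ext h
    · intro h; rw [h]
  simp only [h1, h2]

omit [DecidableEq G] [Fintype G] in
/-- The period lattice of `(⟨g₁⟩, ⟨g₂⟩)` inside a subgroup is that of `(g₁, g₂)`.
[cite: KovalevPryadko2012, §III.C (p0005 L53-56: the identification lattice m₁L₁ + m₂L₂)] -/
theorem isPeriod_subtype_iff (H : AddSubgroup G) (h₁ : g₁ ∈ H) (h₂ : g₂ ∈ H) (m : ℤ × ℤ) :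
    IsPeriod (⟨g₁, h₁⟩ : H) (⟨g₂, h₂⟩ : H) m ↔ IsPeriod g₁ g₂ m := by
  simp only [IsPeriod]
  rw [← Subtype.coe_injective.eq_iff]
  simp

omit [DecidableEq G] [Fintype G] in
/-- … hence the same systole. [cite: KovalevPryadko2012, §III.C (p0005 L77-80: d(L₁,L₂) = min ‖m₁L₁ + m₂L₂‖)] -/
theorem systole_subtype (H : AddSubgroup G) (h₁ : g₁ ∈ H) (h₂ : g₂ ∈ H) :
    systole (⟨g₁, h₁⟩ : H) (⟨g₂, h₂⟩ : H) = systole g₁ g₂ := by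
  simp only [systole, isPeriod_subtype_iff H h₁ h₂]

omit [DecidableEq G] [Fintype G] in
/-- The subgroup `⟨g₁, g₂⟩` is generated, inside itself, by `⟨g₁⟩, ⟨g₂⟩`.
[cite: LinPryadko2024, §4.3 Statement 7 (arXiv:2306.16400 chunk p0010 L47–55)] -/
theorem closure_pair_subtype_eq_top (H : AddSubgroup G) (hH : H = AddSubgroup.closure ({g₁, g₂} : Set G)) :
    AddSubgroup.closure ({(⟨g₁, hH ▸ AddSubgroup.subset_closure (by simp)⟩ : H),
      ⟨g₂, hH ▸ AddSubgroup.subset_closure (by simp)⟩} : Set H) = ⊤ := by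
  subst hH
  rw [eq_top_iff]
  rintro ⟨x, hx⟩ -
  obtain ⟨c, d, hcd⟩ := AddSubgroup.mem_closure_pair.1 hx
  rw [AddSubgroup.mem_closure_pair]
  refine ⟨c, d, Subtype.ext ?_⟩
  simp [hcd]

/-- **`d_Z = sys₁(Λ)` for every code `LP[1 + x^{g₁}, 1 + x^{g₂}]`, for ALL `g₁, g₂`** (generating or not: a
non-generating pair gives `[G : ⟨g₁,g₂⟩]` disjoint copies of the code over `H = ⟨g₁, g₂⟩`, which has the same period
lattice; a zero `gᵢ` makes that block vanish and `d_Z = 1 = sys₁(Λ)`). [cite: KovalevPryadko2012, §III.C (p0005 L74-77: d(L₁,L₂) = min_{m₁,m₂} ‖m₁L₁ + m₂L₂‖)]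
[cite: LinPryadko2024, §4.3 and §IV.G (arXiv:2306.16400 chunk p0010 L1–55: direct sum of double-coset subcodes; p0012 L51–57: W = 4 codes are direct sums of abelian-group codes)] -/
theorem code_dZ_eq_systole (g₁ g₂ : G) : (code g₁ g₂).dZ = systole g₁ g₂ := by
  classical
  set H : AddSubgroup G := AddSubgroup.closure ({g₁, g₂} : Set G) with hH
  have h₁ : g₁ ∈ H := AddSubgroup.subset_closure (by simp)
  have h₂ : g₂ ∈ H := AddSubgroup.subset_closure (by simp)
  have ha : ∀ g, g ∉ H → binom g₁ g = 0 := fun g hg =>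
    binom_eq_zero_of_ne (fun h => hg (h ▸ H.zero_mem)) (fun h => hg (h ▸ h₁))
  have hb : ∀ g, g ∉ H → binom g₂ g = 0 := fun g hg =>
    binom_eq_zero_of_ne (fun h => hg (h ▸ H.zero_mem)) (fun h => hg (h ▸ h₂))
  have hd : (code g₁ g₂).dZ = (code (⟨g₁, h₁⟩ : H) ⟨g₂, h₂⟩).dZ := by
    rw [code, AbelianTwoBlock.css_dZ_eq_restrict H ha hb, restrict_binom H h₁, restrict_binom H h₂]; rfl
  rw [hd, code_dZ (closure_pair_subtype_eq_top H hH), systole_subtype H h₁ h₂]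

/-- `d_X = sys₁(Λ)` likewise. [cite: KovalevPryadko2012, §III.C (p0005 L74-77)]
[cite: LinPryadko2024, §IV.B (abelian G: d_X = d_Z) (arXiv:2306.16400 chunk p0009 L103–106)] -/
theorem code_dX_eq_systole (g₁ g₂ : G) : (code g₁ g₂).dX = systole g₁ g₂ := by
  rw [code, AbelianTwoBlock.css_dX_eq_dZ, ← code, code_dZ_eq_systole g₁ g₂]

/-- **Statement 14 for `LP[1 + x^{g₁}, 1 + x^{g₂}]`: `d_Z² ≤ n`**, `n = |G ⊕ G| = 2|G|`.
[cite: WangPryadko2022, Statement 14 (arXiv:2203.17216 chunk p0010 L59–63)]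
[cite: LinPryadko2024, §IV.G eq. «(d_μ^{(g)})² ≤ n^{(g)}, μ ∈ {X,Z}» (arXiv:2306.16400 chunk p0012 L89–97)] -/
theorem code_dZ_sq_le_card (g₁ g₂ : G) :
    (code g₁ g₂).dZ ^ 2 ≤ Fintype.card (G ⊕ G) := by
  rw [code_dZ_eq_systole g₁ g₂, card_qubits]
  exact systole_sq_le_two_mul_card g₁ g₂

/-- **Statement 14, odd case: `d_Z² + 1 ≤ n`** when `d_Z` is odd.
[cite: WangPryadko2022, Statement 14 (arXiv:2203.17216 chunk p0010 L59–62: odd d = 2r+1 ⟹ n ≥ 1 + d²)]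
[cite: LinPryadko2024, §IV.G «which also gives d² ≤ n^{(g)} − 1 when d ≡ d^{(g)} is odd» (arXiv:2306.16400 chunk p0012 L96–97)] -/
theorem code_dZ_sq_lt_card_of_odd {g₁ g₂ : G} (hodd : Odd (code g₁ g₂).dZ) :
    (code g₁ g₂).dZ ^ 2 < Fintype.card (G ⊕ G) := by
  rw [code_dZ_eq_systole g₁ g₂] at hodd ⊢
  rw [card_qubits]
  exact systole_sq_lt_two_mul_card_of_odd g₁ g₂ hodd

/-- `d_X² ≤ n`. [cite: WangPryadko2022, Statement 14 (arXiv:2203.17216 chunk p0010 L59–63)]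
[cite: LinPryadko2024, §IV.G (arXiv:2306.16400 chunk p0012 L89–97)] -/
theorem code_dX_sq_le_card (g₁ g₂ : G) :
    (code g₁ g₂).dX ^ 2 ≤ Fintype.card (G ⊕ G) := by
  rw [code, AbelianTwoBlock.css_dX_eq_dZ, ← code]; exact code_dZ_sq_le_card g₁ g₂

/-- `d_X² + 1 ≤ n` when `d_X` is odd. [cite: WangPryadko2022, Statement 14 (arXiv:2203.17216 chunk p0010 L59–62)]
[cite: LinPryadko2024, §IV.G (arXiv:2306.16400 chunk p0012 L96–97)] -/
theorem code_dX_sq_lt_card_of_odd {g₁ g₂ : G} (hodd : Odd (code g₁ g₂).dX) :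
    (code g₁ g₂).dX ^ 2 < Fintype.card (G ⊕ G) := by
  rw [code, AbelianTwoBlock.css_dX_eq_dZ, ← code] at hodd ⊢; exact code_dZ_sq_lt_card_of_odd hodd

end Code

end TwistedToric

/-! ## Every abelian two-block code with two weight-two blocks -/

namespace AbelianTwoBlock

open TwistedToric

variable {G : Type*} [AddCommGroup G] [DecidableEq G] [Fintype G]

/-- An `𝔽₂`-valued function is `1` where it is nonzero. [cite: LinPryadko2024, §II (binary field F = 𝔽₂) (arXiv:2306.16400 chunk p0004)] -/
private theorem zmod2_eq_one_of_ne_zero {x : ZMod 2} (h : x ≠ 0) : x = 1 := by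
  revert h; revert x; decide

/-- A weight-two coefficient vector is a translate of `1 + x^{g}` with `g ≠ 0`: `a = binom g (· − p)`, i.e.
`shift (−p) a = binom g`. [cite: LinPryadko2024, §IV.G «up to code equivalence, we can choose a = 1 + λf, b = 1 + μh … non-identity group elements f, h» (arXiv:2306.16400 chunk p0012 L51–54)] -/
theorem exists_shift_eq_binom_of_hammingNorm_eq_two {a : G → ZMod 2} (ha : hammingNorm a = 2) :
    ∃ p g : G, g ≠ 0 ∧ shift (-p) a = binom g := by
  classical
  rw [hammingNorm, Finset.card_eq_two] at ha
  obtain ⟨p, q, hpq, hsupp⟩ := ha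
  have hmem : ∀ x, a x ≠ 0 ↔ x = p ∨ x = q := by
    intro x
    have := Finset.ext_iff.1 hsupp x
    simpa using this
  refine ⟨p, q - p, sub_ne_zero.2 (Ne.symm hpq), funext fun x => ?_⟩
  simp only [shift_apply, sub_neg_eq_add, binom]
  by_cases hx0 : x = 0
  · subst hx0
    have h1 : a p = 1 := zmod2_eq_one_of_ne_zero ((hmem _).2 (Or.inl rfl))
    have h2 : (0 : G) ≠ q - p := by rw [ne_comm, sub_ne_zero]; exact Ne.symm hpq
    simp [h1, h2]
  · by_cases hxq : x = q - p
    · subst hxq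
      have h1 : a q = 1 := zmod2_eq_one_of_ne_zero ((hmem _).2 (Or.inr rfl))
      simp [h1, hx0]
    · have h1 : a (x + p) = 0 := by
        by_contra h
        rcases (hmem _).1 h with h' | h'
        · exact hx0 (by simpa using h')
        · exact hxq (by rw [← h', add_sub_cancel_right])
      simp [h1, hx0, hxq]

/-- **Wang–Pryadko Statement 14 / Lin–Pryadko §IV.G for every abelian two-block code with two weight-two blocks:
`d_Z² ≤ n`.** (GB codes `G = ℤ_ℓ` as printed; BB and abelian 2BGA codes likewise.)
[cite: WangPryadko2022, Statement 14 (arXiv:2203.17216 chunk p0010 L59–63)]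
[cite: LinPryadko2024, §IV.G (arXiv:2306.16400 chunk p0012 L51–57 and L89–97)] -/
theorem css_dZ_sq_le_card_of_weight_two {a b : G → ZMod 2} (ha : hammingNorm a = 2) (hb : hammingNorm b = 2) :
    (css a b).dZ ^ 2 ≤ Fintype.card (G ⊕ G) := by
  obtain ⟨p, g₁, hg₁, hpa⟩ := exists_shift_eq_binom_of_hammingNorm_eq_two ha
  obtain ⟨u, g₂, hg₂, hub⟩ := exists_shift_eq_binom_of_hammingNorm_eq_two hb
  rw [← css_shift_dZ a b (-p) (-u), hpa, hub]
  exact code_dZ_sq_le_card g₁ g₂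

/-- **… and `d_Z² + 1 ≤ n` when `d_Z` is odd.** [cite: WangPryadko2022, Statement 14 (arXiv:2203.17216 chunk p0010 L59–62)]
[cite: LinPryadko2024, §IV.G (arXiv:2306.16400 chunk p0012 L96–97)] -/
theorem css_dZ_sq_lt_card_of_weight_two_of_odd {a b : G → ZMod 2} (ha : hammingNorm a = 2)
    (hb : hammingNorm b = 2) (hodd : Odd (css a b).dZ) : (css a b).dZ ^ 2 < Fintype.card (G ⊕ G) := by
  obtain ⟨p, g₁, hg₁, hpa⟩ := exists_shift_eq_binom_of_hammingNorm_eq_two ha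
  obtain ⟨u, g₂, hg₂, hub⟩ := exists_shift_eq_binom_of_hammingNorm_eq_two hb
  rw [← css_shift_dZ a b (-p) (-u), hpa, hub] at hodd ⊢
  exact code_dZ_sq_lt_card_of_odd hodd

/-- `d_X² ≤ n` for two weight-two blocks. [cite: WangPryadko2022, Statement 14 (arXiv:2203.17216 chunk p0010 L59–63)]
[cite: LinPryadko2024, §IV.G (arXiv:2306.16400 chunk p0012 L89–97)] -/
theorem css_dX_sq_le_card_of_weight_two {a b : G → ZMod 2} (ha : hammingNorm a = 2) (hb : hammingNorm b = 2) :
    (css a b).dX ^ 2 ≤ Fintype.card (G ⊕ G) := by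
  rw [css_dX_eq_dZ]; exact css_dZ_sq_le_card_of_weight_two ha hb

/-- `d_X² + 1 ≤ n` when `d_X` is odd, for two weight-two blocks. [cite: WangPryadko2022, Statement 14 (arXiv:2203.17216 chunk p0010 L59–62)]
[cite: LinPryadko2024, §IV.G (arXiv:2306.16400 chunk p0012 L96–97)] -/
theorem css_dX_sq_lt_card_of_weight_two_of_odd {a b : G → ZMod 2} (ha : hammingNorm a = 2)
    (hb : hammingNorm b = 2) (hodd : Odd (css a b).dX) : (css a b).dX ^ 2 < Fintype.card (G ⊕ G) := by
  rw [css_dX_eq_dZ] at hodd ⊢; exact css_dZ_sq_lt_card_of_weight_two_of_odd ha hb hodd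

end AbelianTwoBlock

end Literature.InformationTheory.QuantumCodes
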